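import Summits.CriticalPhenomena.PercolationContinuityZ3.Theorems.PercNearOneGluingNoHeavyQuantIndepBlobMergeToOneLight
import Summits.CriticalPhenomena.PercolationContinuityZ3.Theorems.PercNearOneGluingNoHeavyQuantIndepBlobExtraBlobs
import HarnessLib

/-!
# QUANT lane R8, T-DIB: Conjecture J′ — the merge induction.  DIB\* on the corner `x > 1/2` for EVERY system follows from its
# Case B ("no light blob is heavy-mergeable, heavy total ≤ 2j")

builds on p205010 (kernel theorem, internal audit signed; external expert review pending)

Support file (`--supports stmt-CriticalPhenomena-4575`), QUANT lane seat prim-quant-p1 (gen 12); memo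
`run/shared/lean/prim/quant/P1-SURPLUS.md` §23.9.  Theorems only; no definitions, no sorries, standard axioms.

SYSTEMS.  Floor `1/2 < x < 1`, gates `p k ∈ [0,1]`, integer sizes; the LIGHT blobs are those with `p k < x` and are required to be
proper (`x² ≤ p k`, `1 ≤ a k ≤ j` — DIB\*'s side condition plus the harmless normalisations "no negative credit, no invisible blob");
the DIB\* credit is `2j < Σ_k a_k ψ*_x(p_k)`, `ψ*_x(g) = g` for `g ≥ x` and `(g − x²)/(1−x)` below.  CASE B is the class of such systems in
which, in addition, the heavy total `A_H = Σ_{x ≤ p k} a_k` is at most `2j` and NO light blob is heavy-mergeable: `p_k · A_H < j` for every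
light `k`.

* `Quant.IndepBlob.corner_of_caseB_le` / `corner_of_caseB` — **if the row `x ≤ P(N ≥ j+1)` holds for every Case-B system (at the
  given `x`, `j`), it holds for every system.**  Induction on the number of light blobs: a heavy-mergeable light `k₀`
  (`j ≤ p k₀ · A_H`) is merged INTO a heavy blob of positive size by p1 g11's size-biased merge step (`Merge.exists_tailMerge_le`,
  the tail does not increase), which keeps the floor, removes one light, keeps the other lights proper and does not decrease the credit
  (`a k₀ · p ℓ ≥ a k₀ · ψ*(p k₀)`); when no light is mergeable, either `A_H ≤ 2j` (Case B) or `A_H ≥ 2j+1` and lead g15's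
  `sizeRow_with_extra_blobs` at the least heavy gate gives the row outright (`corner_of_noMergeable`).
So Conjecture DIB\* on the corner is reduced to Case B, i.e. (by `tail_ge_of_heavyChords`, `cloud_topCell`, `…CloudFitCells`) to the pure
light-cloud chord inequalities (B″) of the memo under per-light non-mergeability; for two lights Case B is `tail_ge_of_twoLights_noMerge`.
[cite: KozmaNitzan2024, Conjecture 3 (p. 15)] (the gluing rows served); [this work].
-/

namespace Summit.CriticalPhenomena.PercolationContinuityZ3.Theorems

namespace Quant

namespace IndepBlob

open Finset

universe u

/-- No light blob heavy-mergeable ⟹ the row, given the Case-B hypothesis `hB` (heavy total `≤ 2j`) or, when the heavy total is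
`≥ 2j + 1`, by `sizeRow_with_extra_blobs` at the least heavy gate. [this work] -/
theorem corner_of_noMergeable {κ : Type u} [Fintype κ] [DecidableEq κ] (x : ℝ) (j : ℕ) (hx : 1 / 2 < x)
    (hB : ∀ {ι : Type u} [Fintype ι] [DecidableEq ι] (p : ι → ℝ) (a : ι → ℕ),
      (∀ k, 0 ≤ p k) → (∀ k, p k ≤ 1) → (∀ k, p k < x → x ^ 2 ≤ p k ∧ 1 ≤ a k ∧ a k ≤ j) →
      (∑ k ∈ (Finset.univ : Finset ι).filter (fun k => x ≤ p k), a k ≤ 2 * j) →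
      (∀ k, p k < x → p k * ((∑ i ∈ (Finset.univ : Finset ι).filter (fun i => x ≤ p i), a i : ℕ) : ℝ) < j) →
      (2 * j : ℝ) < ∑ k, (a k : ℝ) * (if x ≤ p k then p k else (p k - x ^ 2) / (1 - x)) →
      x ≤ ∑ s ∈ (Finset.univ : Finset (Finset ι)).filter (fun s => j + 1 ≤ ∑ k ∈ s, a k),
        (∏ k, if k ∈ s then p k else 1 - p k))
    (p : κ → ℝ) (a : κ → ℕ) (hp0 : ∀ k, 0 ≤ p k) (hp1 : ∀ k, p k ≤ 1)
    (hproper : ∀ k, p k < x → x ^ 2 ≤ p k ∧ 1 ≤ a k ∧ a k ≤ j)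
    (hnm : ∀ k, p k < x → p k * ((∑ i ∈ (Finset.univ : Finset κ).filter (fun i => x ≤ p i), a i : ℕ) : ℝ) < j)
    (hcredit : (2 * j : ℝ) < ∑ k, (a k : ℝ) * (if x ≤ p k then p k else (p k - x ^ 2) / (1 - x))) :
    x ≤ ∑ s ∈ (Finset.univ : Finset (Finset κ)).filter (fun s => j + 1 ≤ ∑ k ∈ s, a k),
      (∏ k, if k ∈ s then p k else 1 - p k) := by
  set H : Finset κ := (Finset.univ : Finset κ).filter (fun i => x ≤ p i) with hH
  by_cases hA : ∑ k ∈ H, a k ≤ 2 * j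
  · exact hB p a hp0 hp1 hproper hA hnm hcredit
  · have hA' : 2 * j + 1 ≤ ∑ k ∈ H, a k := by omega
    have hne : H.Nonempty := by
      by_contra h
      rw [Finset.not_nonempty_iff_eq_empty] at h
      rw [h, Finset.sum_empty] at hA'
      omega
    obtain ⟨y₀, hy₀H, hy₀min⟩ := Finset.exists_min_image H p hne
    have hy₀x : x ≤ p y₀ := (Finset.mem_filter.1 hy₀H).2
    set E : Finset κ := (Finset.univ : Finset κ).filter (fun i => p i < x) with hE
    have hy₀E : y₀ ∉ E := by
      intro h
      have := (Finset.mem_filter.1 h).2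
      linarith
    have hEH : ∀ k, k ∉ E → k ∈ H := by
      intro k hk
      rw [hE, Finset.mem_filter, not_and] at hk
      exact Finset.mem_filter.2 ⟨Finset.mem_univ _, not_lt.1 (hk (Finset.mem_univ _))⟩
    have hsum : ∑ k ∈ H, a k + ∑ k ∈ E, a k = ∑ k, a k := by
      have hHE : H = Eᶜ := by
        ext k
        rw [Finset.mem_compl, hH, hE, Finset.mem_filter, Finset.mem_filter]
        constructor
        · rintro ⟨-, hk⟩ ⟨-, hk'⟩; linarith
        · intro hk; exact ⟨Finset.mem_univ _, not_lt.1 fun h => hk ⟨Finset.mem_univ _, h⟩⟩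
      rw [hHE, Finset.sum_compl_add_sum]
    have hrow := sizeRow_with_extra_blobs p a hp0 hp1 E y₀ hy₀E (fun k hk => hy₀min k (hEH k hk)) (by linarith) j
      (by rw [← hsum]; omega)
    exact le_trans hy₀x hrow

/-- **Conjecture J′'s merge induction: DIB\* on the corner follows from its Case B.**  See the module docstring; `n` bounds the
number of light blobs. [this work] -/
theorem corner_of_caseB_le (x : ℝ) (j : ℕ) (hx : 1 / 2 < x) (hx1 : x < 1)
    (hB : ∀ {ι : Type u} [Fintype ι] [DecidableEq ι] (p : ι → ℝ) (a : ι → ℕ),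
      (∀ k, 0 ≤ p k) → (∀ k, p k ≤ 1) → (∀ k, p k < x → x ^ 2 ≤ p k ∧ 1 ≤ a k ∧ a k ≤ j) →
      (∑ k ∈ (Finset.univ : Finset ι).filter (fun k => x ≤ p k), a k ≤ 2 * j) →
      (∀ k, p k < x → p k * ((∑ i ∈ (Finset.univ : Finset ι).filter (fun i => x ≤ p i), a i : ℕ) : ℝ) < j) →
      (2 * j : ℝ) < ∑ k, (a k : ℝ) * (if x ≤ p k then p k else (p k - x ^ 2) / (1 - x)) →
      x ≤ ∑ s ∈ (Finset.univ : Finset (Finset ι)).filter (fun s => j + 1 ≤ ∑ k ∈ s, a k),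
        (∏ k, if k ∈ s then p k else 1 - p k))
    (n : ℕ) :
    ∀ {κ : Type u} [Fintype κ] [DecidableEq κ] (p : κ → ℝ) (a : κ → ℕ),
      (∀ k, 0 ≤ p k) → (∀ k, p k ≤ 1) → (∀ k, p k < x → x ^ 2 ≤ p k ∧ 1 ≤ a k ∧ a k ≤ j) →
      ((Finset.univ : Finset κ).filter (fun k => p k < x)).card ≤ n →
      (2 * j : ℝ) < ∑ k, (a k : ℝ) * (if x ≤ p k then p k else (p k - x ^ 2) / (1 - x)) →
      x ≤ ∑ s ∈ (Finset.univ : Finset (Finset κ)).filter (fun s => j + 1 ≤ ∑ k ∈ s, a k),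
        (∏ k, if k ∈ s then p k else 1 - p k) := by
  induction n with
  | zero =>
    intro κ _ _ p a hp0 hp1 hproper hcard hcredit
    have hnone : ∀ k, ¬ p k < x := by
      intro k hk
      have : k ∈ (Finset.univ : Finset κ).filter (fun k => p k < x) := Finset.mem_filter.2 ⟨Finset.mem_univ _, hk⟩
      have := Finset.card_pos.2 ⟨k, this⟩
      omega
    exact corner_of_noMergeable x j hx hB p a hp0 hp1 hproper (fun k hk => absurd hk (hnone k)) hcredit
  | succ n ih =>
    intro κ _ _ p a hp0 hp1 hproper hcard hcredit
    by_cases hmer : ∃ k₀, p k₀ < x ∧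
        (j : ℝ) ≤ p k₀ * ((∑ i ∈ (Finset.univ : Finset κ).filter (fun i => x ≤ p i), a i : ℕ) : ℝ)
    swap
    · push Not at hmer
      exact corner_of_noMergeable x j hx hB p a hp0 hp1 hproper hmer hcredit
    obtain ⟨k₀, hk₀x, hk₀M⟩ := hmer
    have hj1 : 1 ≤ j := le_trans (hproper k₀ hk₀x).2.1 (hproper k₀ hk₀x).2.2
    set ι := {k : κ // k ≠ k₀} with hι
    -- targets: the heavy blobs, weighted by size
    set c : ι → ℕ := fun i : ι => if x ≤ p i.1 then a i.1 else 0 with hc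
    set z : Finset ι → ℕ := fun W => ∑ i ∈ W, (if x ≤ p i.1 then 0 else a i.1) with hz
    have hcz : ∀ W : Finset ι, ∑ i ∈ W, c i + z W = ∑ i ∈ W, a i.1 := by
      intro W
      rw [hz, ← Finset.sum_add_distrib]
      refine Finset.sum_congr rfl fun i _ => ?_
      simp only [hc]
      split_ifs <;> simp
    have hk₀not : k₀ ∉ (Finset.univ : Finset κ).filter (fun i => x ≤ p i) := by
      intro h
      have := (Finset.mem_filter.1 h).2
      linarith
    have hSumc : (∑ i : ι, (c i : ℝ)) = ∑ i ∈ (Finset.univ : Finset κ).filter (fun i => x ≤ p i), (a i : ℝ) := by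
      have h1 : (∑ i : ι, (c i : ℝ)) = ∑ i : ι, (if x ≤ p i.1 then (a i.1 : ℝ) else 0) := by
        refine Finset.sum_congr rfl fun i _ => ?_
        simp only [hc]
        split_ifs <;> simp
      rw [h1, ← Finset.sum_filter, sum_filter_subtype_ne k₀ (fun i => x ≤ p i) (fun i => (a i : ℝ)),
        Finset.erase_eq_of_notMem hk₀not]
    have hMc : (j : ℝ) ≤ p k₀ * ∑ i : ι, (c i : ℝ) := by rw [hSumc, ← Nat.cast_sum]; exact hk₀M
    have hpos : ∃ i : ι, 0 < c i := by
      by_contra hnone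
      push Not at hnone
      have h0 : (∑ i : ι, (c i : ℝ)) = 0 := by
        rw [Finset.sum_eq_zero]
        intro i _
        have := hnone i
        have : c i = 0 := by omega
        simp [this]
      rw [h0, mul_zero] at hMc
      have : (1 : ℝ) ≤ j := by exact_mod_cast hj1
      linarith
    -- the product weight on the subtype and THE MERGE STEP
    set μ : Finset ι → ℝ := fun W => ∏ i : ι, (if i ∈ W then p i.1 else 1 - p i.1) with hμ
    have hμ0 : ∀ W, 0 ≤ μ W := fun W =>
      bernoulliWeight_nonneg (p := fun i : ι => p i.1) (fun i => hp0 i.1) (fun i => hp1 i.1) W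
    obtain ⟨ℓ, hcℓ, hmerge⟩ := Merge.exists_tailMerge_le μ hμ0 (fun W => W) z c (a k₀) j (p k₀) hMc hpos
    have hℓ : x ≤ p ℓ.1 := by
      by_contra h
      have : c ℓ = 0 := by simp only [hc]; rw [if_neg h]
      omega
    -- merged sizes
    set a' : ι → ℕ := fun i : ι => a i.1 + (if i = ℓ then a k₀ else 0) with ha'
    have ha'W : ∀ W : Finset ι, ∑ i ∈ W, a' i = ∑ i ∈ W, a i.1 + (if ℓ ∈ W then a k₀ else 0) := by
      intro W
      rw [ha', Finset.sum_add_distrib, Finset.sum_ite_eq' W ℓ]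
    -- (1) original tail = T₀ ; (2) merged tail = tail of `(p, a')` on the subtype
    have hT0 : ∑ s ∈ (Finset.univ : Finset (Finset κ)).filter (fun s => j + 1 ≤ ∑ k ∈ s, a k),
          (∏ k, if k ∈ s then p k else 1 - p k) =
        ∑ W : Finset ι, μ W * (p k₀ * (if j + 1 ≤ ∑ i ∈ W, c i + z W + a k₀ then (1 : ℝ) else 0) +
          (1 - p k₀) * (if j + 1 ≤ ∑ i ∈ W, c i + z W then (1 : ℝ) else 0)) := by
      rw [tail_split p a k₀ (j + 1)]
      simp_rw [hcz]
      rw [Finset.sum_filter, Finset.sum_filter, Finset.mul_sum, Finset.mul_sum, ← Finset.sum_add_distrib]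
      refine Finset.sum_congr rfl fun W _ => ?_
      have e : a k₀ + ∑ i ∈ W, a i.1 = ∑ i ∈ W, a i.1 + a k₀ := by rw [add_comm]
      rw [e]
      split_ifs <;> ring
    have hTℓ : ∑ W : Finset ι, μ W * (if j + 1 ≤ ∑ i ∈ W, c i + z W + (if ℓ ∈ W then a k₀ else 0) then (1 : ℝ) else 0) =
        ∑ W ∈ (Finset.univ : Finset (Finset ι)).filter (fun W => j + 1 ≤ ∑ i ∈ W, a' i), μ W := by
      rw [Finset.sum_filter]
      refine Finset.sum_congr rfl fun W _ => ?_
      rw [hcz W, ← ha'W W]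
      split_ifs <;> simp
    -- (3) hypotheses of the induction hypothesis for the merged system
    have hproper' : ∀ i : ι, p i.1 < x → x ^ 2 ≤ p i.1 ∧ 1 ≤ a' i ∧ a' i ≤ j := by
      intro i hi
      have hiℓ : i ≠ ℓ := by intro h; rw [h] at hi; linarith
      have : a' i = a i.1 := by simp only [ha']; rw [if_neg hiℓ]; rfl
      rw [this]
      exact hproper i.1 hi
    have hcard' : ((Finset.univ : Finset ι).filter (fun i : ι => p i.1 < x)).card ≤ n := by
      have h1 : ((Finset.univ : Finset ι).filter (fun i : ι => p i.1 < x)).card =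
          (((Finset.univ : Finset κ).filter (fun k => p k < x)).erase k₀).card := by
        rw [Finset.card_eq_sum_ones, Finset.card_eq_sum_ones]
        exact sum_filter_subtype_ne k₀ (fun i => p i < x) (fun _ => 1)
      have hk₀L : k₀ ∈ (Finset.univ : Finset κ).filter (fun k => p k < x) := Finset.mem_filter.2 ⟨Finset.mem_univ _, hk₀x⟩
      rw [h1, Finset.card_erase_of_mem hk₀L]
      omega
    have hcredit' : (2 * j : ℝ) < ∑ i : ι, (a' i : ℝ) * (if x ≤ p i.1 then p i.1 else (p i.1 - x ^ 2) / (1 - x)) := by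
      -- old sum split at `k₀`, read on the subtype
      have hsplitK : ∑ k, (a k : ℝ) * (if x ≤ p k then p k else (p k - x ^ 2) / (1 - x)) =
          (a k₀ : ℝ) * ((p k₀ - x ^ 2) / (1 - x)) +
            ∑ i : ι, (a i.1 : ℝ) * (if x ≤ p i.1 then p i.1 else (p i.1 - x ^ 2) / (1 - x)) := by
        have h := sum_filter_subtype_ne k₀ (fun _ => True)
          (fun k => (a k : ℝ) * (if x ≤ p k then p k else (p k - x ^ 2) / (1 - x)))
        rw [Finset.filter_true, Finset.filter_true] at h
        rw [h, ← Finset.add_sum_erase _ _ (Finset.mem_univ k₀), if_neg (not_le.2 hk₀x)]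
      have hnew : ∑ i : ι, (a' i : ℝ) * (if x ≤ p i.1 then p i.1 else (p i.1 - x ^ 2) / (1 - x)) =
          (∑ i : ι, (a i.1 : ℝ) * (if x ≤ p i.1 then p i.1 else (p i.1 - x ^ 2) / (1 - x))) + (a k₀ : ℝ) * p ℓ.1 := by
        have e : ∀ i : ι, (a' i : ℝ) * (if x ≤ p i.1 then p i.1 else (p i.1 - x ^ 2) / (1 - x)) =
            (a i.1 : ℝ) * (if x ≤ p i.1 then p i.1 else (p i.1 - x ^ 2) / (1 - x)) +
              (if i = ℓ then (a k₀ : ℝ) * p ℓ.1 else 0) := by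
          intro i
          simp only [ha']
          split_ifs with h h'
          · subst h; push_cast; ring
          · subst h; exact absurd hℓ h'
          · push_cast; ring
          · push_cast; ring
        rw [Finset.sum_congr rfl fun i _ => e i, Finset.sum_add_distrib, Finset.sum_ite_eq' Finset.univ ℓ,
          if_pos (Finset.mem_univ _)]
      have hε : 0 < 1 - x := by linarith
      have hκle : (p k₀ - x ^ 2) / (1 - x) ≤ p ℓ.1 := by
        rw [div_le_iff₀ hε]
        have := mul_le_mul_of_nonneg_left hk₀x.le (hp0 k₀)
        nlinarith [this, hp0 k₀]
      have hgain : (a k₀ : ℝ) * ((p k₀ - x ^ 2) / (1 - x)) ≤ (a k₀ : ℝ) * p ℓ.1 :=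
        mul_le_mul_of_nonneg_left hκle (Nat.cast_nonneg _)
      rw [hnew]
      rw [hsplitK] at hcredit
      linarith
    have IH := ih (κ := ι) (fun i : ι => p i.1) a' (fun i => hp0 i.1) (fun i => hp1 i.1) hproper' hcard' hcredit'
    -- (4) assemble
    calc x ≤ ∑ W ∈ (Finset.univ : Finset (Finset ι)).filter (fun W => j + 1 ≤ ∑ i ∈ W, a' i), μ W := IH
      _ = ∑ W : Finset ι, μ W *
            (if j + 1 ≤ ∑ i ∈ W, c i + z W + (if ℓ ∈ W then a k₀ else 0) then (1 : ℝ) else 0) := hTℓ.symm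
      _ ≤ _ := hmerge
      _ = _ := hT0.symm

/-- **DIB\* on the corner ⟸ its Case B** (no bound on the number of lights). [this work] -/
theorem corner_of_caseB {κ : Type u} [Fintype κ] [DecidableEq κ] (x : ℝ) (j : ℕ) (hx : 1 / 2 < x) (hx1 : x < 1)
    (hB : ∀ {ι : Type u} [Fintype ι] [DecidableEq ι] (p : ι → ℝ) (a : ι → ℕ),
      (∀ k, 0 ≤ p k) → (∀ k, p k ≤ 1) → (∀ k, p k < x → x ^ 2 ≤ p k ∧ 1 ≤ a k ∧ a k ≤ j) →
      (∑ k ∈ (Finset.univ : Finset ι).filter (fun k => x ≤ p k), a k ≤ 2 * j) →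
      (∀ k, p k < x → p k * ((∑ i ∈ (Finset.univ : Finset ι).filter (fun i => x ≤ p i), a i : ℕ) : ℝ) < j) →
      (2 * j : ℝ) < ∑ k, (a k : ℝ) * (if x ≤ p k then p k else (p k - x ^ 2) / (1 - x)) →
      x ≤ ∑ s ∈ (Finset.univ : Finset (Finset ι)).filter (fun s => j + 1 ≤ ∑ k ∈ s, a k),
        (∏ k, if k ∈ s then p k else 1 - p k))
    (p : κ → ℝ) (a : κ → ℕ) (hp0 : ∀ k, 0 ≤ p k) (hp1 : ∀ k, p k ≤ 1)
    (hproper : ∀ k, p k < x → x ^ 2 ≤ p k ∧ 1 ≤ a k ∧ a k ≤ j)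
    (hcredit : (2 * j : ℝ) < ∑ k, (a k : ℝ) * (if x ≤ p k then p k else (p k - x ^ 2) / (1 - x))) :
    x ≤ ∑ s ∈ (Finset.univ : Finset (Finset κ)).filter (fun s => j + 1 ≤ ∑ k ∈ s, a k),
      (∏ k, if k ∈ s then p k else 1 - p k) :=
  corner_of_caseB_le x j hx hx1 hB _ p a hp0 hp1 hproper le_rfl hcredit

end IndepBlob

end Quant

end Summit.CriticalPhenomena.PercolationContinuityZ3.Theorems
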